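import Mathlib
import Summits.Ventures.HodgeRepro2.A2TripleSumGysin

/-!
# A2 annex — the Weil projection `p_W` of the model and `p_W(y') = 0` (Corollary A8.2, literally)

Corollary A8.2 (route/T4-A2-p6.md v6 ll. 115–118) concludes `p_W(y') = 0` from
`⟨y', θ⁸ ∧ w_σ⟩ = 0` for all `σ` by the detection Lemma A5.6 of sub-claim A3 — in the twelve-plane
model: the coefficient of the Weil monomial `w_σ̄` in the monomial expansion of a class `y` is, up to
sign, `∫_B y ∧ E_{I_σ} ∧ w_σ` (p5's `integral_sum_mul_ET_mul_weil` in coordinates).  With the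
monomial basis `aBasis` of `A2ModelDuality` this file makes `p_W` a DEFINITION and proves the
corollary in that literal form:

* `weilIndex P₀ s`: the index set of the Weil monomial `w = weil P₀ s` in `aBasis`;
  `aBasis_weilIndex` (`aBasis (weilIndex P₀ s) = ± weil P₀ s`), `aBasis_compl_weilIndex`
  (`aBasis (weilIndex P₀ s)ᶜ = ± E_{univ ∖ P₀} ∧ weil P₀ (!s)`);
* **`repr_weilIndex`** (Lemma A5.6 in the model): the `w_{P₀,s}`-coordinate of any `y` is
  `± ∫_B y ∧ E_{univ ∖ P₀} ∧ weil P₀ (!s)`;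
* **`weilProjModel W y`**: the projection of `y` onto the span of the Weil monomials of a family `W` of Weil
  data (in the section, `W = {w_σ : σ ∈ Σ}`), in the monomial basis;
* **`weilProjModel_eq_zero_of_forall_integral`**: `p_W(y) = 0` as soon as every pairing
  `∫_B y ∧ E_{I} ∧ w` with the complementary Weil monomials vanishes;
* **`weilProjModel_gysinTriple_eq_zero`** (COROLLARY A8.2): `p_W(m₃_*(z₁ ⊗ z₂ ⊗ θ^r)) = 0` for every
  family `W` of Weil data of a common size `r`, under the hypotheses of `A2TripleSumGysin` for each
  datum (`z₂ ∈ ⋀^{2|ι| − 2}`; Prop. A8.1 for `c₂` against each `w`; all `c_p ≠ 0`).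

Seat p6 (A2 owner), gen 16.  §8 (d): uses an L-value-free non-vanishing device: NO.
-/

namespace Summit.Ventures.HodgeRepro2.A2WeilProjection

open WeilPlanes WeilIntegral WeilDetect A2TripleSumPairing A2TripleSumPairingDegree A2ModelDuality
  A2IntegralDegree A2TripleSumGysin

variable {ι : Type*} [DecidableEq ι] [Fintype ι]

/-- The index set of the Weil monomial `weil P₀ s` in the monomial basis `aBasis`. -/
noncomputable def weilIndex (P₀ : Finset ι) (s : Bool) : Finset (Fin (Fintype.card (Gen ι))) :=
  (weilList P₀ s).toFinset.image enum

/-- Membership in `weilIndex`. -/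
theorem mem_weilIndex (P₀ : Finset ι) (s : Bool) (k : Fin (Fintype.card (Gen ι))) :
    k ∈ weilIndex P₀ s ↔ enum.symm k ∈ weilList P₀ s := by
  rw [weilIndex, Finset.mem_image]
  constructor
  · rintro ⟨j, hj, rfl⟩
    rwa [Equiv.symm_apply_apply, ← List.mem_toFinset]
  · intro h
    exact ⟨enum.symm k, List.mem_toFinset.mpr h, Equiv.apply_symm_apply _ _⟩

/-- `genListOf (weilIndex P₀ s)` is a permutation of `weilList P₀ s`. -/
theorem genListOf_weilIndex_perm (P₀ : Finset ι) (s : Bool) :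
    (genListOf (weilIndex P₀ s)).Perm (weilList P₀ s) := by
  refine List.perm_of_nodup_nodup_toFinset_eq (nodup_genListOf _) (nodup_weilList P₀ s) ?_
  ext j
  rw [List.mem_toFinset, List.mem_toFinset, mem_genListOf, mem_weilIndex, Equiv.symm_apply_apply]

/-- The basis vector of `weilIndex P₀ s` is `± weil P₀ s`. -/
theorem aBasis_weilIndex (P₀ : Finset ι) (s : Bool) :
    ∃ ε : ℂ, (ε = 1 ∨ ε = -1) ∧ (aBasis (weilIndex P₀ s) : A ι) = ε • weil P₀ s := by
  rw [aBasis_apply, weil]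
  exact WeilVector.mono_perm (genListOf_weilIndex_perm P₀ s)

/-- `genListOf (weilIndex P₀ s)ᶜ` is a permutation of `planeList (univ ∖ P₀) ++ weilList P₀ (!s)`. -/
theorem genListOf_compl_weilIndex_perm (P₀ : Finset ι) (s : Bool) :
    (genListOf (weilIndex P₀ s)ᶜ).Perm (planeList (Finset.univ \ P₀) ++ weilList P₀ (!s)) := by
  refine List.perm_of_nodup_nodup_toFinset_eq (nodup_genListOf _) ?_ ?_
  · refine List.nodup_append.mpr ⟨nodup_planeList _, nodup_weilList _ _, ?_⟩
    intro j hj j' hj' hjj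
    subst hjj
    rw [mem_planeList, Finset.mem_sdiff] at hj
    rw [mem_weilList] at hj'
    exact hj.2 hj'.1
  · ext j
    rw [List.mem_toFinset, List.mem_toFinset, mem_genListOf, Finset.mem_compl, mem_weilIndex,
      Equiv.symm_apply_apply, List.mem_append, mem_planeList, mem_weilList, mem_weilList,
      Finset.mem_sdiff]
    constructor
    · intro h
      by_cases hP : j.1 ∈ P₀
      · right
        refine ⟨hP, ?_⟩
        rcases Bool.eq_or_eq_not j.2 s with h2 | h2
        · exact absurd ⟨hP, h2⟩ h
        · exact h2
      · exact Or.inl ⟨Finset.mem_univ _, hP⟩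
    · rintro (⟨_, hP⟩ | ⟨_, h2⟩) ⟨hP', h2'⟩
      · exact hP hP'
      · rw [h2'] at h2
        exact Bool.not_eq_not.mpr rfl h2 |>.elim

/-- The basis vector of `(weilIndex P₀ s)ᶜ` is `± E_{univ ∖ P₀} ∧ weil P₀ (!s)`. -/
theorem aBasis_compl_weilIndex (P₀ : Finset ι) (s : Bool) :
    ∃ ε : ℂ, (ε = 1 ∨ ε = -1) ∧
      (aBasis (weilIndex P₀ s)ᶜ : A ι) = ε • (ET (Finset.univ \ P₀) * weil P₀ (!s)) := by
  rw [aBasis_apply, weil, ET_eq_mono, ← mono_append]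
  exact WeilVector.mono_perm (genListOf_compl_weilIndex_perm P₀ s)

/-- **Lemma A5.6 in the model**: the `w_{P₀,s}`-coordinate of `y` in the monomial basis is
`± ∫_B y ∧ E_{univ ∖ P₀} ∧ w_{P₀,!s}`. -/
theorem repr_weilIndex (y : A ι) (P₀ : Finset ι) (s : Bool) :
    ∃ ε : ℂ, (ε = 1 ∨ ε = -1) ∧
      (aBasis (ι := ι)).repr y (weilIndex P₀ s) =
        ε * integral (y * (ET (Finset.univ \ P₀) * weil P₀ (!s))) := by
  obtain ⟨ε₁, hε₁, h₁⟩ := integral_mul_aBasis_compl y (weilIndex P₀ s)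
  obtain ⟨ε₂, hε₂, h₂⟩ := aBasis_compl_weilIndex P₀ s
  refine ⟨ε₁ * ε₂, ?_, ?_⟩
  · rcases hε₁ with rfl | rfl <;> rcases hε₂ with rfl | rfl <;> norm_num
  · have hε₁' : ε₁ * ε₁ = 1 := by rcases hε₁ with rfl | rfl <;> norm_num
    rw [h₂, mul_smul_comm, map_smul, smul_eq_mul] at h₁
    calc (aBasis (ι := ι)).repr y (weilIndex P₀ s)
        = (aBasis (ι := ι)).repr y (weilIndex P₀ s) * (ε₁ * ε₁) := by rw [hε₁', mul_one]
      _ = ((aBasis (ι := ι)).repr y (weilIndex P₀ s) * ε₁) * ε₁ := by ring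
      _ = ε₁ * ε₂ * integral (y * (ET (Finset.univ \ P₀) * weil P₀ (!s))) := by
          rw [← h₁]; ring

/-- The Weil projection of the model: the component of `y` along the Weil monomials of the family
`W` of Weil data `(P₀, s)`, in the monomial basis. -/
noncomputable def weilProjModel (W : Finset (Finset ι × Bool)) (y : A ι) : A ι :=
  ∑ d ∈ W, (aBasis (ι := ι)).repr y (weilIndex d.1 d.2) • aBasis (weilIndex d.1 d.2)

/-- `p_W(y) = 0` as soon as every pairing of `y` with the complementary Weil monomials vanishes. -/
theorem weilProjModel_eq_zero_of_forall_integral (W : Finset (Finset ι × Bool)) (y : A ι)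
    (h : ∀ d ∈ W, integral (y * (ET (Finset.univ \ d.1) * weil d.1 (!d.2))) = 0) :
    weilProjModel W y = 0 := by
  refine Finset.sum_eq_zero fun d hd => ?_
  obtain ⟨ε, _, hε⟩ := repr_weilIndex y d.1 d.2
  rw [hε, h d hd, mul_zero, zero_smul]

/-- **Corollary A8.2, literally: `p_W(y') = 0`.**  For a family `W` of Weil data of common size `r`
and `y' = m₃_*(z₁ ⊗ z₂ ⊗ θ^r)` with `z₂ ∈ ⋀^{2|ι| − 2}` pairing to zero with every
`e_{a,!s} ∧ e_{b,!s}` for each `(P₀, s) ∈ W` (Proposition A8.1 for `c₂`) and all `c_p ≠ 0`. -/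
theorem weilProjModel_gysinTriple_eq_zero (hι : 1 ≤ Fintype.card ι) (W : Finset (Finset ι × Bool))
    (r : ℕ) (hW : ∀ d ∈ W, d.1.card = r) (c : ι → ℂ) (hc : ∀ p, c p ≠ 0) (z₁ : A ι) {z₂ : A ι}
    (hz₂ : z₂ ∈ (⋀[ℂ]^(2 * Fintype.card ι - 2) (V ι) : Submodule ℂ (A ι)))
    (hA81 : ∀ d ∈ W, ∀ a ∈ d.1, ∀ b ∈ d.1, a ≠ b →
      integral (z₂ * (gen (a, !d.2) * gen (b, !d.2))) = 0) :
    weilProjModel W (gysinTriple (integral ∘ₗ LinearMap.mulLeft ℂ z₁)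
      (integral ∘ₗ LinearMap.mulLeft ℂ z₂) (psi c r)) = 0 := by
  apply weilProjModel_eq_zero_of_forall_integral
  intro d hd
  have := weilCoordinate_gysinTriple_eq_zero hι d.1 (!d.2) c hc z₁ hz₂ (hA81 d hd)
  rwa [hW d hd] at this

end Summit.Ventures.HodgeRepro2.A2WeilProjection
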